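import Literature.Probability.RandomPlanarGeometry.HexSAWBrickWallSlab
import Literature.Probability.RandomPlanarGeometry.HexSAWBrickWallStripFugacity
import Mathlib.Analysis.SpecialFunctions.Pow.Real
import Mathlib.Analysis.SpecialFunctions.Pow.Continuity
import HarnessLib

/-!
# Armchair slabs of the honeycomb lattice with a surface fugacity: `Ĉ_{T,n}(y,1)` and the growth rates `μ_H(y)`

Topic `Literature/Probability/RandomPlanarGeometry` (continues `HexSAWBrickWallSlab.lean` — the column slabs
`Slab_H = {0 ≤ x₀ ≤ H}` of the brick wall, i.e. the strips of Beaton's ROTATED (armchair) honeycomb lattice,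
`HexBW.slabPairs H n` (starting site in the cross-section `{0,…,H} × {0,1}`, translate), `HexBW.slabCount`,
`HexBW.slabConnectiveConstant` — and reuses `HexBW.yK y = max 1 y⁻¹` of `HexSAWBrickWallStripFugacity.lean`).  Source: N. R. Beaton, *The critical surface fugacity of self-avoiding walks on a rotated
honeycomb lattice*, J. Phys. A 47 (2014) 075003, arXiv:1210.0274v3, §3.2 (p. 15): Proposition 8 ("`lim Ĉ_{T,n}(y,z)^{1/n}
=: μ_T(y,z)` … `μ_T(y,z) = μ_T(z,y)`, and so in particular `μ_T(y,1) = μ_T(1,y)`") and Proposition 9 ("For `y > 0`,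
`μ_T(1,y) < μ_{T+1}(1,y)`").  Here the walks are the translation classes of `HexSAWBrickWallSlab.lean` (both cosets, any
start in the cross-section — not rooted as printed; the growth rates agree by the usual unfolding argument, which is
not formalised here) and the surface weight sits on the column `x₀ = 0`.  This file is the armchair twin of
`HexSAWBrickWallStripFugacity.lean` (same proofs, coordinates swapped); slabs need `H ≥ 1` to contain long walks.

## Main definitions and statements (namespace `Literature.Probability.RandomPlanarGeometry.SAW.HexBW`, all PROVED)

* `leftVisits a υ n` (the number of vertices of the placed walk in the column `x₀ = 0`), `slabZ H n y = Ĉ_{H,n}(y,1)` over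
  translation classes;
* **`slabZ_add_le`** — `Ĉ_{H,N+M}(y) ≤ max(1, y⁻¹) · Ĉ_{H,N}(y) · Ĉ_{H,M}(y)`;
* `slabMuY H y := inf_N (max(1,y⁻¹) Ĉ_{H,N}(y))^{1/N}`, **`tendsto_slabZ_rpow`** (`Ĉ_{H,n}(y)^{1/n} → μ_H(y)`, `H ≥ 1`),
  `pow_slabMuY_le`, `slabMuY_pos` (`H ≥ 1`), `one_le_slabMuY` (`H ≥ 2`), `slabMuY_mono`.

The strict inequality of Proposition 9 for every `y > 0` is `HexSAWBrickWallSlabFugacityStrict.lean`.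
-/

noncomputable section

open Filter Topology Finset Literature.Probability.LatticeModels Literature.Probability.Percolation SimpleGraph

namespace Literature.Probability.RandomPlanarGeometry.SAW.HexBW

/-! ### The column-zero visit count and the partition function -/

/-- The number of vertices of the placed walk `m ↦ a + υ m`, `m ≤ n`, in the boundary column `x₀ = 0`.
[cite: Beaton2014RotatedHoneycomb, §3.2, Proposition 8 (arXiv:1210.0274v3 p. 15: Ĉ_{T,n}(y,z), vertices in the boundary)] -/
def leftVisits (a : Site 2) (υ : ℕ → Site 2) (n : ℕ) : ℕ :=
  ∑ m ∈ Finset.range (n + 1), if (a + υ m) 0 = 0 then 1 else 0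

/-- **`Ĉ_{H,n}(y,1)`**: the partition function of the `n`-step walks of the slab `Slab_H` (translation classes) with a
fugacity `y` per vertex in the column `x₀ = 0`. [cite: Beaton2014RotatedHoneycomb, §3.2, Proposition 8 (arXiv:1210.0274v3 p. 15)] -/
def slabZ (H n : ℕ) (y : ℝ) : ℝ := ∑ p ∈ slabPairs H n, y ^ leftVisits p.1 p.2 n

/-- `leftVisits ≤ n + 1`. [cite: Beaton2014RotatedHoneycomb, §3.2, Proposition 8 (arXiv:1210.0274v3 p. 15)] -/
theorem leftVisits_le (a : Site 2) (υ : ℕ → Site 2) (n : ℕ) : leftVisits a υ n ≤ n + 1 := by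
  unfold leftVisits
  calc ∑ m ∈ Finset.range (n + 1), (if (a + υ m) 0 = 0 then 1 else 0)
      ≤ ∑ _m ∈ Finset.range (n + 1), 1 := Finset.sum_le_sum fun m _ => by split_ifs <;> omega
    _ = n + 1 := by simp

/-- The zigzag walk translated by an even vector `a` is a walk of `Slab_H` when its two columns fit.
[cite: MadrasSlade1993, §8.2, eq. (8.2.1), p. 267] -/
theorem zigzag_mem_slabPairs {H : ℕ} (n : ℕ) {a : Site 2} (ha : a ∈ slabStarts H) (hpar : (a 0 + a 1) % 2 = 0)
    (hcol : a 0 + 1 ≤ (H : ℤ)) : (a, zigzagWalk n) ∈ slabPairs H n := by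
  have hbw : ∀ i < n, brickWallGraph.Adj (zigzagWalk n i) (zigzagWalk n (i + 1)) := by
    intro i hi
    rw [brickWallGraph_adj_coord, zigzagWalk_apply_zero, zigzagWalk_apply_zero, zigzagWalk_apply_one,
      zigzagWalk_apply_one, Nat.min_eq_left hi.le, Nat.min_eq_left (by omega : i + 1 ≤ n)]
    push_cast
    omega
  have ha0 := (mem_slabStarts.1 ha).1.1
  refine mem_slabPairs.2 ⟨ha, Zd.mem_saws.2 ⟨?_, fun i hi => ?_, fun i hi => zd_adj_of_adj (hbw i hi), ?_⟩,
    fun i hi => (adj_add_left_iff_of_even hpar _ _).2 (hbw i hi), fun m _ => ?_⟩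
  · ext j
    fin_cases j <;> simp [zigzagWalk]
  · ext j
    fin_cases j <;> simp [zigzagWalk, Nat.min_eq_right hi]
  · intro i hi j hj hij
    simp only [Set.mem_setOf_eq] at hi hj
    dsimp only at hij
    have h0 := congrFun hij 0
    have h1 := congrFun hij 1
    rw [zigzagWalk_apply_zero, zigzagWalk_apply_zero, Nat.min_eq_left hi, Nat.min_eq_left hj] at h0
    rw [zigzagWalk_apply_one, zigzagWalk_apply_one, Nat.min_eq_left hi, Nat.min_eq_left hj] at h1
    omega
  · simp only [InSlab, Pi.add_apply, zigzagWalk_apply_zero]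
    constructor <;> omega

/-- `0 < Ĉ_{H,n}(y)` for `y > 0`, `H ≥ 1`. [cite: Beaton2014RotatedHoneycomb, §3.2, Proposition 8 (arXiv:1210.0274v3 p. 15)] -/
theorem slabZ_pos {H : ℕ} (hH : 1 ≤ H) (n : ℕ) {y : ℝ} (hy : 0 < y) : 0 < slabZ H n y := by
  unfold slabZ
  have hne : (slabPairs H n).Nonempty := Finset.card_pos.1 (one_le_slabCount hH n)
  exact Finset.sum_pos (fun p _ => pow_pos hy _) hne

/-- **`min(1,y)^{n+1} ≤ Ĉ_{H,n}(y)`** (`H ≥ 1`): one walk alone. [cite: Beaton2014RotatedHoneycomb, §3.2, Proposition 8 (arXiv:1210.0274v3 p. 15)] -/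
theorem min_pow_le_slabZ {H : ℕ} (hH : 1 ≤ H) (n : ℕ) {y : ℝ} (hy : 0 < y) : (min 1 y) ^ (n + 1) ≤ slabZ H n y := by
  have hmem : ((0 : Site 2), zigzagWalk n) ∈ slabPairs H n :=
    zigzag_mem_slabPairs n (zero_mem_slabStarts H) (by simp) (by simp; exact_mod_cast hH)
  have hterm : (min 1 y) ^ (n + 1) ≤ y ^ leftVisits (0 : Site 2) (zigzagWalk n) n := by
    have hV := leftVisits_le (0 : Site 2) (zigzagWalk n) n
    rcases le_or_gt 1 y with h1 | h1
    · rw [min_eq_left h1, one_pow]; exact one_le_pow₀ h1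
    · rw [min_eq_right h1.le]; exact pow_le_pow_of_le_one hy.le h1.le hV
  unfold slabZ
  exact hterm.trans (Finset.single_le_sum (f := fun p => y ^ leftVisits p.1 p.2 n)
    (fun p _ => pow_nonneg hy.le _) hmem)

/-- For `H ≥ 2` the zigzag in the columns `1, 2` has no vertex in the column `0`: **`1 ≤ Ĉ_{H,n}(y)`**.
[cite: Beaton2014RotatedHoneycomb, §3.2, Proposition 8 (arXiv:1210.0274v3 p. 15)] -/
theorem one_le_slabZ {H : ℕ} (hH : 2 ≤ H) (n : ℕ) {y : ℝ} (hy : 0 < y) : 1 ≤ slabZ H n y := by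
  set a : Site 2 := ![1, 1] with ha
  have ha0 : a 0 = 1 := by rw [ha]; rfl
  have ha1 : a 1 = 1 := by rw [ha]; rfl
  have has : a ∈ slabStarts H :=
    mem_slabStarts.2 ⟨⟨by rw [ha0]; norm_num, by rw [ha0]; exact_mod_cast (by omega : 1 ≤ H)⟩,
      by rw [ha1]; norm_num, by rw [ha1]⟩
  have hmem : (a, zigzagWalk n) ∈ slabPairs H n :=
    zigzag_mem_slabPairs n has (by rw [ha0, ha1]; decide) (by rw [ha0]; exact_mod_cast hH)
  have hcol : ∀ m, (a + zigzagWalk n m) 0 ≠ 0 := fun m => by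
    simp only [Pi.add_apply, ha0, zigzagWalk_apply_zero]; omega
  have hterm : (1 : ℝ) ≤ y ^ leftVisits a (zigzagWalk n) n := by
    have : leftVisits a (zigzagWalk n) n = 0 := by
      unfold leftVisits
      exact Finset.sum_eq_zero fun m _ => by rw [if_neg (hcol m)]
    rw [this, pow_zero]
  unfold slabZ
  exact hterm.trans (Finset.single_le_sum (f := fun p => y ^ leftVisits p.1 p.2 n)
    (fun p _ => pow_nonneg hy.le _) hmem)

/-! ### Submultiplicativity with the surface weight -/

/-- The splitting map of (8.2.2) for slabs: first `N` steps, then the last `M` steps translated back (vertically) to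
the cross-section. [cite: MadrasSlade1993, §8.2, eq. (8.2.2), p. 268] -/
def slabSplit (N M : ℕ) (p : Site 2 × (ℕ → Site 2)) : (Site 2 × (ℕ → Site 2)) × (Site 2 × (ℕ → Site 2)) :=
  ((p.1, fun i => p.2 (min i N)), (vnorm (p.1 + p.2 N), fun i => p.2 (N + min i M) - p.2 N))

/-- The two halves of a walk of `Slab_H` are walks of `Slab_H`. [cite: MadrasSlade1993, §8.2, eq. (8.2.2), p. 268] -/
theorem slabSplit_mem {H N M : ℕ} {p : Site 2 × (ℕ → Site 2)} (hp : p ∈ slabPairs H (N + M)) :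
    slabSplit N M p ∈ slabPairs H N ×ˢ slabPairs H M := by
  classical
  obtain ⟨a, ω⟩ := p
  rw [mem_slabPairs] at hp
  obtain ⟨ha, hω, hbw, hR⟩ := hp
  obtain ⟨h0, hend, hadj, hinj⟩ := Zd.mem_saws.1 hω
  rw [slabSplit, Finset.mem_product, mem_slabPairs, mem_slabPairs]
  refine ⟨⟨ha, Zd.mem_saws.2 ⟨by simpa using h0, ?_, ?_, ?_⟩, ?_, ?_⟩,
    vnorm_mem_slabStarts (hR N (Nat.le_add_right N M)), Zd.mem_saws.2 ⟨by simp, ?_, ?_, ?_⟩, ?_, ?_⟩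
  · intro i hi
    simp [min_eq_right hi]
  · intro i hi
    have h1 : min i N = i := min_eq_left hi.le
    have h2 : min (i + 1) N = i + 1 := min_eq_left (by omega)
    simp only [h1, h2]
    exact hadj i (by omega)
  · intro i hi j hj hij
    simp only [Set.mem_setOf_eq] at hi hj
    simp only [min_eq_left hi, min_eq_left hj] at hij
    exact hinj (by simp only [Set.mem_setOf_eq]; omega)
      (by simp only [Set.mem_setOf_eq]; omega) hij
  · intro i hi
    have h1 : min i N = i := min_eq_left hi.le
    have h2 : min (i + 1) N = i + 1 := min_eq_left (by omega)
    simp only [h1, h2]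
    exact hbw i (by omega)
  · intro m hm
    simp only [min_eq_left hm]
    exact hR m (by omega)
  · intro i hi
    simp [min_eq_right hi]
  · intro i hi
    have h1 : min i M = i := min_eq_left hi.le
    have h2 : min (i + 1) M = i + 1 := min_eq_left (by omega)
    simp only [h1, h2]
    rw [Zd.zdGraph_adj_sub_right, ← add_assoc]
    exact hadj (N + i) (by omega)
  · intro i hi j hj hij
    simp only [Set.mem_setOf_eq] at hi hj
    simp only [min_eq_left hi, min_eq_left hj, sub_left_inj] at hij
    have := hinj (by simp only [Set.mem_setOf_eq]; omega)
      (by simp only [Set.mem_setOf_eq]; omega) hij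
    omega
  · intro i hi
    have h1 : min i M = i := min_eq_left hi.le
    have h2 : min (i + 1) M = i + 1 := min_eq_left (by omega)
    simp only [h1, h2]
    have key : brickWallGraph.Adj (a + ω (N + i)) (a + ω (N + i + 1)) := hbw (N + i) (by omega)
    have e1 : a + ω N - vnorm (a + ω N) + (vnorm (a + ω N) + (ω (N + i) - ω N)) =
        a + ω (N + i) := by abel
    have e2 : a + ω N - vnorm (a + ω N) + (vnorm (a + ω N) + (ω (N + (i + 1)) - ω N)) =
        a + ω (N + i + 1) := by rw [← add_assoc N i 1]; abel
    rw [← adj_add_left_iff_of_even (vnorm_shift_even (a + ω N)), e1, e2]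
    exact key
  · intro m hm
    simp only [min_eq_left hm]
    have hin := hR (N + m) (by omega)
    refine ⟨?_, ?_⟩
    · have := hin.1
      simp only [Pi.add_apply, Pi.sub_apply, vnorm_apply_zero] at this ⊢
      linarith
    · have := hin.2
      simp only [Pi.add_apply, Pi.sub_apply, vnorm_apply_zero] at this ⊢
      linarith

/-- The splitting map is injective on the walks of `Slab_H`. [cite: MadrasSlade1993, §8.2, eq. (8.2.2), p. 268] -/
theorem slabSplit_injOn (H N M : ℕ) : Set.InjOn (slabSplit N M) ↑(slabPairs H (N + M)) := by
  rintro ⟨a, ω⟩ hp ⟨a', ω'⟩ hp' h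
  rw [Finset.mem_coe, mem_slabPairs] at hp hp'
  dsimp only at hp hp'
  have hω := Zd.mem_saws.1 hp.2.1
  have hω' := Zd.mem_saws.1 hp'.2.1
  simp only [slabSplit, Prod.mk.injEq] at h
  obtain ⟨⟨rfl, h1⟩, -, h2⟩ := h
  simp only [Prod.mk.injEq, true_and]
  have hn : ω N = ω' N := by simpa using congrFun h1 N
  funext i
  rcases le_or_gt i N with hi | hi
  · simpa [min_eq_left hi] using congrFun h1 i
  · obtain ⟨j, rfl⟩ : ∃ j, i = N + j := ⟨i - N, by omega⟩
    rcases le_or_gt j M with hj | hj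
    · have := congrFun h2 j
      simp only [min_eq_left hj] at this
      rwa [hn, sub_left_inj] at this
    · have := congrFun h2 M
      simp only [min_self] at this
      rw [hn, sub_left_inj] at this
      rw [hω.2.1 (N + j) (by omega), hω'.2.1 (N + j) (by omega), this]

/-- The column-zero vertices of a walk are those of its two halves, the split vertex counted twice.
[cite: Beaton2014RotatedHoneycomb, §3.2, Proposition 8 (arXiv:1210.0274v3 p. 15: concatenation)] -/
theorem leftVisits_split (a : Site 2) (ω : ℕ → Site 2) (N M : ℕ) :
    leftVisits a ω (N + M) + (if (a + ω N) 0 = 0 then 1 else 0) =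
      leftVisits (slabSplit N M (a, ω)).1.1 (slabSplit N M (a, ω)).1.2 N +
        leftVisits (slabSplit N M (a, ω)).2.1 (slabSplit N M (a, ω)).2.2 M := by
  unfold leftVisits slabSplit
  simp only
  have e1 : ∑ m ∈ Finset.range (N + 1), (if (a + ω (min m N)) 0 = 0 then 1 else 0) =
      ∑ m ∈ Finset.range (N + 1), (if (a + ω m) 0 = 0 then 1 else 0) :=
    Finset.sum_congr rfl fun m hm => by rw [min_eq_left (Nat.lt_succ_iff.1 (Finset.mem_range.1 hm))]
  have e2 : ∑ m ∈ Finset.range (M + 1),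
      (if (vnorm (a + ω N) + (ω (N + min m M) - ω N)) 0 = 0 then 1 else 0) =
      ∑ m ∈ Finset.range (M + 1), (if (a + ω (N + m)) 0 = 0 then 1 else 0) :=
    Finset.sum_congr rfl fun m hm => by
      rw [min_eq_left (Nat.lt_succ_iff.1 (Finset.mem_range.1 hm))]
      have : (vnorm (a + ω N) + (ω (N + m) - ω N)) 0 = (a + ω (N + m)) 0 := by
        simp only [Pi.add_apply, Pi.sub_apply, vnorm_apply_zero]; ring
      rw [this]
  rw [e1, e2, show N + M + 1 = (N + 1) + M by ring, Finset.sum_range_add, Finset.sum_range_succ' (n := M)]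
  simp only [add_zero]
  have e3 : ∀ m, N + 1 + m = N + (m + 1) := fun m => by ring
  simp only [e3]
  ring

/-- **Submultiplicativity with the surface weight**: `Ĉ_{H,N+M}(y) ≤ max(1, y⁻¹) · Ĉ_{H,N}(y) · Ĉ_{H,M}(y)`.
[cite: Beaton2014RotatedHoneycomb, §3.2, Proposition 8 (arXiv:1210.0274v3 p. 15: existence of μ_T(y,z) by concatenation/unfolding)] -/
theorem slabZ_add_le (H N M : ℕ) {y : ℝ} (hy : 0 < y) :
    slabZ H (N + M) y ≤ yK y * slabZ H N y * slabZ H M y := by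
  classical
  have hK := one_le_yK y
  have hpt : ∀ p ∈ slabPairs H (N + M), y ^ leftVisits p.1 p.2 (N + M) ≤
      yK y * (y ^ leftVisits (slabSplit N M p).1.1 (slabSplit N M p).1.2 N *
        y ^ leftVisits (slabSplit N M p).2.1 (slabSplit N M p).2.2 M) := by
    rintro ⟨a, ω⟩ -
    have e := leftVisits_split a ω N M
    rw [← pow_add, ← e, pow_add]
    split_ifs
    · rw [pow_one]
      calc y ^ leftVisits a ω (N + M) = y⁻¹ * (y ^ leftVisits a ω (N + M) * y) := by
            field_simp
        _ ≤ yK y * (y ^ leftVisits a ω (N + M) * y) :=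
            mul_le_mul_of_nonneg_right (inv_le_yK y) (by positivity)
    · rw [pow_zero, mul_one]
      calc y ^ leftVisits a ω (N + M) = 1 * y ^ leftVisits a ω (N + M) := (one_mul _).symm
        _ ≤ yK y * y ^ leftVisits a ω (N + M) := mul_le_mul_of_nonneg_right hK (by positivity)
  have hnn : ∀ q ∈ slabPairs H N ×ˢ slabPairs H M,
      0 ≤ y ^ leftVisits q.1.1 q.1.2 N * y ^ leftVisits q.2.1 q.2.2 M := fun q _ => by positivity
  calc slabZ H (N + M) y
      ≤ ∑ p ∈ slabPairs H (N + M), yK y * (y ^ leftVisits (slabSplit N M p).1.1 (slabSplit N M p).1.2 N *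
          y ^ leftVisits (slabSplit N M p).2.1 (slabSplit N M p).2.2 M) := Finset.sum_le_sum hpt
    _ = yK y * ∑ q ∈ (slabPairs H (N + M)).image (slabSplit N M),
          y ^ leftVisits q.1.1 q.1.2 N * y ^ leftVisits q.2.1 q.2.2 M := by
        rw [Finset.mul_sum, Finset.sum_image (slabSplit_injOn H N M)]
    _ ≤ yK y * ∑ q ∈ slabPairs H N ×ˢ slabPairs H M,
          y ^ leftVisits q.1.1 q.1.2 N * y ^ leftVisits q.2.1 q.2.2 M := by
        refine mul_le_mul_of_nonneg_left (Finset.sum_le_sum_of_subset_of_nonneg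
          (fun q hq => ?_) fun q hq _ => hnn q hq) (by linarith)
        obtain ⟨p, hp, rfl⟩ := Finset.mem_image.1 hq
        exact slabSplit_mem hp
    _ = yK y * slabZ H N y * slabZ H M y := by
        rw [Finset.sum_product, slabZ, slabZ, mul_assoc, Finset.sum_mul_sum]

/-! ### The growth rate `μ_H(y)` and the Fekete limit -/

/-- **`μ_H(y) = μ_H(y,1) := inf_N (max(1,y⁻¹) Ĉ_{H,N}(y))^{1/N}`** (equal to `lim Ĉ_{H,N}(y)^{1/N}`, `tendsto_slabZ_rpow`).
[cite: Beaton2014RotatedHoneycomb, §3.2, Proposition 8 (arXiv:1210.0274v3 p. 15: μ_T(y,z) := lim Ĉ_{T,n}(y,z)^{1/n})] -/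
def slabMuY (H : ℕ) (y : ℝ) : ℝ := ⨅ n : ℕ, (yK y * slabZ H (n + 1) y) ^ (1 / ((n : ℝ) + 1))

/-- `μ_H(y) ≤ (max(1,y⁻¹) Ĉ_{H,n}(y))^{1/n}` for `n ≥ 1`. [cite: Beaton2014RotatedHoneycomb, §3.2, Proposition 8 (arXiv:1210.0274v3 p. 15)] -/
theorem slabMuY_le_rpow {H : ℕ} (hH : 1 ≤ H) {y : ℝ} (hy : 0 < y) {n : ℕ} (hn : n ≠ 0) :
    slabMuY H y ≤ (yK y * slabZ H n y) ^ (1 / (n : ℝ)) := by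
  obtain ⟨m, rfl⟩ := Nat.exists_eq_succ_of_ne_zero hn
  have hb : BddBelow (Set.range fun m : ℕ => (yK y * slabZ H (m + 1) y) ^ (1 / ((m : ℝ) + 1))) :=
    ⟨0, by
      rintro _ ⟨m, rfl⟩
      exact Real.rpow_nonneg (mul_nonneg (by linarith [one_le_yK y]) (slabZ_pos hH _ hy).le) _⟩
  have := ciInf_le hb m
  simpa [slabMuY, Nat.cast_succ] using this

/-- **`μ_H(y)ⁿ ≤ max(1,y⁻¹) Ĉ_{H,n}(y)`** (`H ≥ 1`). [cite: Beaton2014RotatedHoneycomb, §3.2, Proposition 8 (arXiv:1210.0274v3 p. 15)] -/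
theorem pow_slabMuY_le {H : ℕ} (hH : 1 ≤ H) (n : ℕ) {y : ℝ} (hy : 0 < y) (hμ : 0 ≤ slabMuY H y) :
    slabMuY H y ^ n ≤ yK y * slabZ H n y := by
  have hKZ : 0 ≤ yK y * slabZ H n y := mul_nonneg (by linarith [one_le_yK y]) (slabZ_pos hH n hy).le
  rcases Nat.eq_zero_or_pos n with rfl | hn
  · rw [pow_zero]
    have := min_pow_le_slabZ hH 0 hy
    rw [zero_add, pow_one] at this
    rcases le_or_gt 1 y with h1 | h1
    · rw [min_eq_left h1] at this
      calc (1 : ℝ) = 1 * 1 := by ring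
        _ ≤ yK y * slabZ H 0 y := mul_le_mul (one_le_yK y) this zero_le_one (by linarith [one_le_yK y])
    · rw [min_eq_right h1.le] at this
      calc (1 : ℝ) = y⁻¹ * y := by field_simp
        _ ≤ yK y * slabZ H 0 y := mul_le_mul (inv_le_yK y) this hy.le (by linarith [one_le_yK y])
  · have h := slabMuY_le_rpow hH hy hn.ne'
    calc slabMuY H y ^ n ≤ ((yK y * slabZ H n y) ^ (1 / (n : ℝ))) ^ n := pow_le_pow_left₀ hμ h n
      _ = yK y * slabZ H n y := by rw [one_div, Real.rpow_inv_natCast_pow hKZ hn.ne']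

/-- **`Ĉ_{H,n}(y)^{1/n} → μ_H(y)`** (`H ≥ 1`; Fekete's lemma for `log(max(1,y⁻¹) Ĉ_{H,n}(y))`).
[cite: Beaton2014RotatedHoneycomb, §3.2, Proposition 8 (arXiv:1210.0274v3 p. 15: lim Ĉ_{T,n}(y,z)^{1/n} = μ_T(y,z))] -/
theorem tendsto_slabZ_rpow {H : ℕ} (hH : 1 ≤ H) {y : ℝ} (hy : 0 < y) :
    Tendsto (fun n : ℕ => (slabZ H n y) ^ (1 / (n : ℝ))) atTop (𝓝 (slabMuY H y)) := by
  have hK := one_le_yK y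
  have hK0 : 0 < yK y := by linarith
  have hpos : ∀ n, 0 < yK y * slabZ H n y := fun n => mul_pos hK0 (slabZ_pos hH n hy)
  have hu : Subadditive fun n => Real.log (yK y * slabZ H n y) := by
    intro m n
    rw [← Real.log_mul (hpos m).ne' (hpos n).ne']
    apply Real.log_le_log (hpos _)
    have h := slabZ_add_le H m n hy
    calc yK y * slabZ H (m + n) y ≤ yK y * (yK y * slabZ H m y * slabZ H n y) :=
          mul_le_mul_of_nonneg_left h hK0.le
      _ = yK y * slabZ H m y * (yK y * slabZ H n y) := by ring
  have hmin : 0 < min 1 y := lt_min one_pos hy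
  have hbdd : BddBelow (Set.range fun n : ℕ => Real.log (yK y * slabZ H n y) / n) := by
    refine ⟨2 * Real.log (min 1 y), ?_⟩
    rintro _ ⟨n, rfl⟩
    have hlog0 : Real.log (min 1 y) ≤ 0 := Real.log_nonpos hmin.le (min_le_left _ _)
    rcases Nat.eq_zero_or_pos n with rfl | hn
    · simp only [Nat.cast_zero, div_zero]; linarith
    · have h1 : (min 1 y) ^ (n + 1) ≤ yK y * slabZ H n y :=
        (min_pow_le_slabZ hH n hy).trans (le_mul_of_one_le_left (slabZ_pos hH n hy).le hK)
      have h2 : ((n : ℝ) + 1) * Real.log (min 1 y) ≤ Real.log (yK y * slabZ H n y) := by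
        have := Real.log_le_log (pow_pos hmin _) h1
        rwa [Real.log_pow, Nat.cast_succ] at this
      rw [le_div_iff₀ (by exact_mod_cast hn)]
      have hn1 : (1 : ℝ) ≤ n := by exact_mod_cast hn
      nlinarith
  have hlim := hu.tendsto_lim hbdd
  have hKlim : Tendsto (fun n : ℕ => (yK y) ^ (1 / (n : ℝ))) atTop (𝓝 1) := by
    have h1 : Tendsto (fun n : ℕ => Real.log (yK y) / (n : ℝ)) atTop (𝓝 0) :=
      tendsto_const_div_atTop_nhds_zero_nat _
    have h2 := (Real.continuous_exp.tendsto _).comp h1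
    rw [Real.exp_zero] at h2
    refine h2.congr fun n => ?_
    rw [Function.comp_apply, Real.rpow_def_of_pos hK0, mul_one_div]
  have key : ∀ n : ℕ, (yK y * slabZ H n y) ^ (1 / (n : ℝ)) = Real.exp (Real.log (yK y * slabZ H n y) / n) :=
    fun n => by rw [Real.rpow_def_of_pos (hpos n), mul_one_div]
  have hexp : Tendsto (fun n : ℕ => (yK y * slabZ H n y) ^ (1 / (n : ℝ))) atTop (𝓝 (Real.exp hu.lim)) := by
    rw [show (fun n : ℕ => (yK y * slabZ H n y) ^ (1 / (n : ℝ))) =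
      fun n => Real.exp (Real.log (yK y * slabZ H n y) / n) from funext key]
    exact (Real.continuous_exp.tendsto _).comp hlim
  have hid : Real.exp hu.lim = slabMuY H y := by
    apply le_antisymm
    · refine le_ciInf fun n => ?_
      have h1 := hu.lim_le_div hbdd (Nat.succ_ne_zero n)
      have h2 := Real.exp_le_exp.2 h1
      rw [← key (n + 1)] at h2
      simpa [Nat.cast_succ] using h2
    · refine ge_of_tendsto hexp ?_
      filter_upwards [eventually_ge_atTop 1] with n hn
      exact slabMuY_le_rpow hH hy (by omega)
  have hprod : Tendsto (fun n : ℕ => (yK y)⁻¹ ^ (1 / (n : ℝ)) * (yK y * slabZ H n y) ^ (1 / (n : ℝ))) atTop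
      (𝓝 (slabMuY H y)) := by
    have h1 : Tendsto (fun n : ℕ => (yK y)⁻¹ ^ (1 / (n : ℝ))) atTop (𝓝 1) := by
      have := hKlim.inv₀ one_ne_zero
      rw [inv_one] at this
      refine this.congr fun n => ?_
      rw [Real.inv_rpow hK0.le]
    have := h1.mul hexp
    rwa [one_mul, hid] at this
  refine hprod.congr fun n => ?_
  rw [← Real.mul_rpow (inv_nonneg.2 hK0.le) (hpos n).le, ← mul_assoc, inv_mul_cancel₀ hK0.ne', one_mul]

/-- `0 < μ_H(y)` for `H ≥ 1`. [cite: Beaton2014RotatedHoneycomb, §3.2, Proposition 8 (arXiv:1210.0274v3 p. 15)] -/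
theorem slabMuY_pos {H : ℕ} (hH : 1 ≤ H) {y : ℝ} (hy : 0 < y) : 0 < slabMuY H y := by
  have hmin : 0 < min 1 y := lt_min one_pos hy
  have hK := one_le_yK y
  have h : (min 1 y) ^ 2 ≤ slabMuY H y := by
    refine le_ciInf fun n => ?_
    have h1 : (min 1 y) ^ (n + 1 + 1) ≤ yK y * slabZ H (n + 1) y :=
      (min_pow_le_slabZ hH (n + 1) hy).trans (le_mul_of_one_le_left (slabZ_pos hH _ hy).le hK)
    have h2 : ((min 1 y) ^ (n + 1 + 1)) ^ (1 / ((n : ℝ) + 1)) ≤ (yK y * slabZ H (n + 1) y) ^ (1 / ((n : ℝ) + 1)) :=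
      Real.rpow_le_rpow (pow_nonneg hmin.le _) h1 (by positivity)
    refine le_trans ?_ h2
    rw [← Real.rpow_natCast (min 1 y) (n + 1 + 1), ← Real.rpow_mul hmin.le]
    have hle1 : min 1 y ≤ 1 := min_le_left _ _
    have hexp : ((n + 1 + 1 : ℕ) : ℝ) * (1 / ((n : ℝ) + 1)) ≤ 2 := by
      rw [mul_one_div, div_le_iff₀ (by positivity)]; push_cast; linarith
    calc (min 1 y) ^ 2 = (min 1 y) ^ (2 : ℝ) := by norm_cast
      _ ≤ (min 1 y) ^ (((n + 1 + 1 : ℕ) : ℝ) * (1 / ((n : ℝ) + 1))) :=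
          Real.rpow_le_rpow_of_exponent_ge hmin hle1 hexp
  exact lt_of_lt_of_le (pow_pos hmin 2) h

/-- **`1 ≤ μ_H(y)` for `H ≥ 2`** (the walks avoiding the column `0`). [cite: Beaton2014RotatedHoneycomb, §3.2, Proposition 8 (arXiv:1210.0274v3 p. 15)] -/
theorem one_le_slabMuY {H : ℕ} (hH : 2 ≤ H) {y : ℝ} (hy : 0 < y) : 1 ≤ slabMuY H y := by
  refine le_ciInf fun n => ?_
  have h1 : (1 : ℝ) ≤ yK y * slabZ H (n + 1) y :=
    (one_le_slabZ hH (n + 1) hy).trans (le_mul_of_one_le_left (slabZ_pos (by omega) _ hy).le (one_le_yK y))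
  exact Real.one_le_rpow h1 (by positivity)

/-- `Ĉ_{H,n}(y) ≤ Ĉ_{H',n}(y)` for `H ≤ H'`. [cite: Beaton2014RotatedHoneycomb, §3.2, Proposition 9 (arXiv:1210.0274v3 p. 15)] -/
theorem slabZ_mono {H H' : ℕ} (hH : H ≤ H') (n : ℕ) {y : ℝ} (hy : 0 < y) : slabZ H n y ≤ slabZ H' n y := by
  unfold slabZ
  refine Finset.sum_le_sum_of_subset_of_nonneg (fun p hp => ?_) fun p _ _ => pow_nonneg hy.le _
  rw [mem_slabPairs] at hp ⊢
  exact ⟨slabStarts_mono hH hp.1, hp.2.1, hp.2.2.1, fun m hm => (hp.2.2.2 m hm).mono hH⟩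

/-- `μ_H(y) ≤ μ_{H'}(y)` for `1 ≤ H ≤ H'`. [cite: Beaton2014RotatedHoneycomb, §3.2, Proposition 9 (arXiv:1210.0274v3 p. 15)] -/
theorem slabMuY_mono {H H' : ℕ} (hH1 : 1 ≤ H) (hH : H ≤ H') {y : ℝ} (hy : 0 < y) : slabMuY H y ≤ slabMuY H' y := by
  refine le_ciInf fun n => ?_
  refine (slabMuY_le_rpow hH1 hy (Nat.succ_ne_zero n)).trans ?_
  rw [Nat.cast_succ]
  have hK0 : 0 ≤ yK y := by linarith [one_le_yK y]
  exact Real.rpow_le_rpow (mul_nonneg hK0 (slabZ_pos hH1 _ hy).le)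
    (mul_le_mul_of_nonneg_left (slabZ_mono hH (n + 1) hy) hK0) (by positivity)

end Literature.Probability.RandomPlanarGeometry.SAW.HexBW
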